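import Mathlib
import Literature.NumberTheory.LFunctions.MertensElementary
import Literature.NumberTheory.LFunctions.MertensFormula
import HarnessLib

/-!
# Zhang (2022) §15 p.87, toolkit: Euler-product majorants for `Σ τ₂(n)²w(n)/n` over numbers with
# prescribed prime factors, and the Mertens inputs (`Σ_{p≤x} 1/p ≤ log log x + 4`, window form)

Topic `Literature/NumberTheory/LFunctions/Zhang2022` (Landau–Siegel audit tree; verdict-neutral).
Y. Zhang, *Discrete mean estimates and the Landau–Siegel zero*, arXiv:2211.02515v1 (2022)
[Zhang2022LandauSiegel] — an unrefereed manuscript under adjudication; nothing here asserts or denies its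
Theorems 1–2. ZHANG-L discharge lane (WP15): the elementary majorants behind the step "This yields, by
(15.21), `Σ_{n∉𝒩(𝒬),n<T} χ(n)τ₂(n)ϖ₁ⱼ(n)/n ≪ 1/𝓛`" (§15 p.87, tex L4314; typed leaf
`Typed.Section15C.Step15_u050`). No definition of the manuscript is touched; every statement here is an
elementary inequality proved from Mathlib (`EulerProduct.summable_and_hasSum_factoredNumbers_prod_filter_prime_tsum`,
`Nat.factoredNumbers`) and the tree's Mertens files (`MertensBound.sum_inv_prime_le`,
`Mertens.abs_primeRecipSum_sub_le`).

## Content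

* `summable_sq_mul_pow` — `Σ_{a≥0} (a+1)²xᵃ ≤ 1 + 4x + 180x²` for `0 ≤ x ≤ 1/2` (the local Euler factor of
  `Σ τ₂(n)²/nˢ` at `x = q⁻¹`; only the leading `4x` matters downstream).
* `tauSqW_mul`, `tauSqW_prime_pow`, `tsum_tauSqW_prime_pow_le` — the multiplicative weight
  `t_w(n) = τ₂(n)²·(∏_{q∣n} w(q))/n` (`w ≥ 0` on primes), written out (no definition is introduced).
* `sum_tauSqW_le_exp` — **the majorant**: for a finite set `F` of `s`-factored numbers,
  `Σ_{n∈F} t_w(n) ≤ exp(Σ_{p∈s prime} w(p)(4/p + 180/p²))`.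
* `sum_inv_primesBelow_le`, `sum_inv_primes_Ioc_le` — Mertens: `Σ_{p<X} 1/p ≤ log log X + 4` and the
  window form `Σ_{A<p≤B} 1/p ≤ log log B − log log A + 24` (`2 ≤ A ≤ B`), from the tree's Mertens files.

## References

* Y. Zhang, arXiv:2211.02515v1 (2022), §15 p.87. [cite: Zhang2022LandauSiegel, §15 p.87]
* G. H. Hardy, E. M. Wright, *An Introduction to the Theory of Numbers*, Thm 427 (Mertens).
  [cite: HardyWright2008, Thm 427]
-/

noncomputable section

open Real Finset Filter
open _root_.Topology

namespace Literature.NumberTheory.LFunctions.Zhang2022.EulerMajorant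

/-! ## §1. The local factor `Σ_{a≥0} (a+1)² xᵃ` -/

/-- `(a+3)² ≤ 9·(19/10)ᵃ` for every `a` (ratio `((a+4)/(a+3))² ≤ 16/9 < 19/10`). [folklore] -/
private theorem sq_add_three_le (a : ℕ) : ((a : ℝ) + 3) ^ 2 ≤ 9 * (19 / 10 : ℝ) ^ a := by
  induction a with
  | zero => norm_num
  | succ n ih =>
    have h1 : ((n : ℝ) + 1 + 3) ^ 2 ≤ (19 / 10) * ((n : ℝ) + 3) ^ 2 := by
      have hn : (0 : ℝ) ≤ n := Nat.cast_nonneg n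
      nlinarith
    calc (((n + 1 : ℕ) : ℝ) + 3) ^ 2 = ((n : ℝ) + 1 + 3) ^ 2 := by push_cast; ring
      _ ≤ (19 / 10) * ((n : ℝ) + 3) ^ 2 := h1
      _ ≤ (19 / 10) * (9 * (19 / 10 : ℝ) ^ n) := by gcongr
      _ = 9 * (19 / 10 : ℝ) ^ (n + 1) := by ring

/-- For `0 ≤ x ≤ 1/2`: the series `Σ_{a≥0} (a+1)²xᵃ` converges and is at most `1 + 4x + 180x²`
(the terms `a ≥ 2` are `≤ 9x²(19/20)^{a−2}`). [folklore] -/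
private theorem summable_sq_mul_pow {x : ℝ} (hx0 : 0 ≤ x) (hx : x ≤ 1 / 2) :
    Summable (fun a : ℕ => ((a : ℝ) + 1) ^ 2 * x ^ a) ∧
      ∑' a : ℕ, ((a : ℝ) + 1) ^ 2 * x ^ a ≤ 1 + 4 * x + 180 * x ^ 2 := by
  set g : ℕ → ℝ := fun a => ((a : ℝ) + 1) ^ 2 * x ^ a with hg
  -- the shifted tail is dominated by a geometric series
  have hdom : ∀ a : ℕ, g (a + 2) ≤ 9 * x ^ 2 * (19 / 20 : ℝ) ^ a := by
    intro a
    have h1 : (((a + 2 : ℕ) : ℝ) + 1) ^ 2 = ((a : ℝ) + 3) ^ 2 := by push_cast; ring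
    have h2 : x ^ (a + 2) = x ^ 2 * x ^ a := by ring
    rw [hg]
    simp only
    rw [h1, h2]
    have h3 : x ^ a ≤ (1 / 2 : ℝ) ^ a := pow_le_pow_left₀ hx0 hx a
    have h4 : ((a : ℝ) + 3) ^ 2 * x ^ a ≤ 9 * (19 / 10 : ℝ) ^ a * (1 / 2 : ℝ) ^ a :=
      mul_le_mul (sq_add_three_le a) h3 (pow_nonneg hx0 a) (by positivity)
    have h5 : (19 / 10 : ℝ) ^ a * (1 / 2 : ℝ) ^ a = (19 / 20 : ℝ) ^ a := by
      rw [← mul_pow]; norm_num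
    calc ((a : ℝ) + 3) ^ 2 * (x ^ 2 * x ^ a) = x ^ 2 * (((a : ℝ) + 3) ^ 2 * x ^ a) := by ring
      _ ≤ x ^ 2 * (9 * (19 / 10 : ℝ) ^ a * (1 / 2 : ℝ) ^ a) := by gcongr
      _ = 9 * x ^ 2 * (19 / 20 : ℝ) ^ a := by rw [mul_assoc 9, h5]; ring
  have hg0 : ∀ a, 0 ≤ g a := fun a => by rw [hg]; positivity
  have hgeom : Summable (fun a : ℕ => 9 * x ^ 2 * (19 / 20 : ℝ) ^ a) :=
    (summable_geometric_of_lt_one (by norm_num) (by norm_num)).mul_left _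
  have htail : Summable (fun a : ℕ => g (a + 2)) :=
    Summable.of_nonneg_of_le (fun a => hg0 _) hdom hgeom
  have hsum : Summable g := (summable_nat_add_iff 2).mp htail
  refine ⟨hsum, ?_⟩
  have hsplit := hsum.sum_add_tsum_nat_add 2
  rw [← hsplit]
  have htail_le : ∑' a : ℕ, g (a + 2) ≤ ∑' a : ℕ, 9 * x ^ 2 * (19 / 20 : ℝ) ^ a :=
    htail.tsum_le_tsum hdom hgeom
  have hgeomval : ∑' a : ℕ, 9 * x ^ 2 * (19 / 20 : ℝ) ^ a = 180 * x ^ 2 := by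
    rw [tsum_mul_left, tsum_geometric_of_lt_one (by norm_num) (by norm_num)]; norm_num; ring
  have h01 : ∑ i ∈ Finset.range 2, g i = 1 + 4 * x := by
    rw [hg]; simp [Finset.sum_range_succ]; norm_num
  rw [h01]
  linarith

/-! ## §2. The multiplicative weight `t_w(n) = τ₂(n)²(∏_{q∣n} w(q))/n`

No definition is introduced (the lane files theorem-only modules): the weight is written out as
`((n.divisors.card : ℝ) ^ 2 * ∏ q ∈ n.primeFactors, w q) / n` in every statement. -/

/-- `t_w(1) = 1`. [cite: Zhang2022LandauSiegel, §15 p.87] -/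
theorem tauSqW_one (w : ℕ → ℝ) :
    (((1 : ℕ).divisors.card : ℝ) ^ 2 * ∏ q ∈ (1 : ℕ).primeFactors, w q) / ((1 : ℕ) : ℝ) = 1 := by
  simp

/-- `t_w` is multiplicative on coprime arguments (`τ₂`, `∏_{q∣n}`, `1/n` all are).
[cite: Zhang2022LandauSiegel, §15 p.87] -/
theorem tauSqW_mul (w : ℕ → ℝ) {m n : ℕ} (hmn : Nat.Coprime m n) :
    (((m * n).divisors.card : ℝ) ^ 2 * ∏ q ∈ (m * n).primeFactors, w q) / ((m * n : ℕ) : ℝ) =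
      ((m.divisors.card : ℝ) ^ 2 * ∏ q ∈ m.primeFactors, w q) / (m : ℝ) *
        (((n.divisors.card : ℝ) ^ 2 * ∏ q ∈ n.primeFactors, w q) / (n : ℝ)) := by
  have hτ : ((m * n).divisors.card : ℝ) = (m.divisors.card : ℝ) * (n.divisors.card : ℝ) := by
    have h := (ArithmeticFunction.isMultiplicative_sigma (k := 0)).map_mul_of_coprime hmn
    simp only [ArithmeticFunction.sigma_zero_apply] at h
    exact_mod_cast h
  rw [hτ, Nat.Coprime.primeFactors_mul hmn, Finset.prod_union hmn.disjoint_primeFactors]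
  push_cast
  rcases Nat.eq_zero_or_pos m with hm | hm
  · subst hm; simp
  rcases Nat.eq_zero_or_pos n with hn | hn
  · subst hn; simp
  have hm' : (m : ℝ) ≠ 0 := by exact_mod_cast hm.ne'
  have hn' : (n : ℝ) ≠ 0 := by exact_mod_cast hn.ne'
  field_simp

/-- `t_w(qᵃ) = (a+1)²w(q)/qᵃ` for a prime `q` and `a ≥ 1`. [cite: Zhang2022LandauSiegel, §15 p.87] -/
theorem tauSqW_prime_pow (w : ℕ → ℝ) {q : ℕ} (hq : q.Prime) {a : ℕ} (ha : a ≠ 0) :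
    (((q ^ a).divisors.card : ℝ) ^ 2 * ∏ p ∈ (q ^ a).primeFactors, w p) / ((q ^ a : ℕ) : ℝ) =
      ((a : ℝ) + 1) ^ 2 * w q / (q : ℝ) ^ a := by
  have hτ : ((q ^ a).divisors.card : ℝ) = (a : ℝ) + 1 := by
    have h := ArithmeticFunction.sigma_zero_apply_prime_pow (i := a) hq
    rw [ArithmeticFunction.sigma_zero_apply] at h
    exact_mod_cast h
  rw [hτ, Nat.primeFactors_prime_pow ha hq, Finset.prod_singleton]
  push_cast
  ring

/-- `t_w ≥ 0` when `w ≥ 0`. [cite: Zhang2022LandauSiegel, §15 p.87] -/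
theorem tauSqW_nonneg {w : ℕ → ℝ} (hw : ∀ q, 0 ≤ w q) (n : ℕ) :
    0 ≤ ((n.divisors.card : ℝ) ^ 2 * ∏ q ∈ n.primeFactors, w q) / (n : ℝ) := by
  have : 0 ≤ ∏ q ∈ n.primeFactors, w q := Finset.prod_nonneg fun q _ => hw q
  positivity

/-- The local Euler factor of `t_w` at a prime `q`: `Σ_{a≥0} t_w(qᵃ)` converges and is at most
`1 + w(q)(4/q + 180/q²)` (`tsum` form; `w ≥ 0`). [cite: Zhang2022LandauSiegel, §15 p.87] -/
theorem tsum_tauSqW_prime_pow_le {w : ℕ → ℝ} (hw : ∀ q, 0 ≤ w q) {q : ℕ} (hq : q.Prime) :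
    Summable (fun a : ℕ =>
      ‖(((q ^ a).divisors.card : ℝ) ^ 2 * ∏ p ∈ (q ^ a).primeFactors, w p) / ((q ^ a : ℕ) : ℝ)‖) ∧
      ∑' a : ℕ, (((q ^ a).divisors.card : ℝ) ^ 2 * ∏ p ∈ (q ^ a).primeFactors, w p) /
          ((q ^ a : ℕ) : ℝ) ≤ 1 + w q * (4 / q + 180 / (q : ℝ) ^ 2) := by
  set t : ℕ → ℝ := fun n => ((n.divisors.card : ℝ) ^ 2 * ∏ p ∈ n.primeFactors, w p) / (n : ℝ)
    with ht
  show Summable (fun a : ℕ => ‖t (q ^ a)‖) ∧ ∑' a : ℕ, t (q ^ a) ≤ 1 + w q * (4 / q + 180 / (q : ℝ) ^ 2)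
  have hq2 : (2 : ℝ) ≤ q := by exact_mod_cast hq.two_le
  have hq0 : (0 : ℝ) < q := by linarith
  set x : ℝ := 1 / q with hxdef
  have hx0 : 0 ≤ x := by rw [hxdef]; positivity
  have hx : x ≤ 1 / 2 := by
    rw [hxdef]; exact one_div_le_one_div_of_le (by norm_num) hq2
  obtain ⟨hsg, hsg_le⟩ := summable_sq_mul_pow hx0 hx
  -- the terms for `a ≥ 1`; at `a = 0` the value is `1`
  set g : ℕ → ℝ := fun a => ((a : ℝ) + 1) ^ 2 * x ^ a with hg
  have hterm : ∀ a : ℕ, t (q ^ a) = if a = 0 then 1 else w q * g a := by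
    intro a
    split_ifs with ha
    · rw [ha, pow_zero, ht]; exact tauSqW_one w
    · rw [ht]
      simp only
      rw [tauSqW_prime_pow w hq ha, hg, hxdef]
      simp only
      rw [one_div, inv_pow]
      ring
  have hg0 : ∀ a, 0 ≤ g a := fun a => by rw [hg]; positivity
  have hbound : ∀ a : ℕ, ‖t (q ^ a)‖ ≤ g a + w q * g a := by
    intro a
    rw [hterm a]
    split_ifs with ha
    · rw [ha, norm_one, hg]; simp; nlinarith [hw q]
    · rw [Real.norm_eq_abs, abs_of_nonneg (mul_nonneg (hw q) (hg0 a))]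
      nlinarith [hg0 a]
  have hsum : Summable (fun a : ℕ => ‖t (q ^ a)‖) :=
    Summable.of_nonneg_of_le (fun a => norm_nonneg _) hbound (hsg.add (hsg.mul_left _))
  refine ⟨hsum, ?_⟩
  have hs' : Summable (fun a : ℕ => t (q ^ a)) := hsum.of_norm
  -- split off `a = 0`
  rw [hs'.tsum_eq_zero_add]
  have h0 : t (q ^ 0) = 1 := by rw [hterm 0, if_pos rfl]
  rw [h0]
  have htail : ∑' a : ℕ, t (q ^ (a + 1)) = w q * ∑' a : ℕ, g (a + 1) := by
    rw [← tsum_mul_left]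
    refine tsum_congr fun a => ?_
    rw [hterm (a + 1), if_neg (Nat.succ_ne_zero a)]
  rw [htail]
  have hgtail : ∑' a : ℕ, g (a + 1) = (∑' a : ℕ, g a) - 1 := by
    rw [hsg.tsum_eq_zero_add]
    have : g 0 = 1 := by rw [hg]; simp
    rw [this]; ring
  rw [hgtail]
  have hx1 : 4 * x + 180 * x ^ 2 = 4 / q + 180 / (q : ℝ) ^ 2 := by
    rw [hxdef]; field_simp
  rw [← hx1]
  have hle : (∑' a : ℕ, g a) - 1 ≤ 4 * x + 180 * x ^ 2 := by linarith
  have hwq := hw q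
  nlinarith

/-! ## §3. The majorant over `s`-factored numbers -/

/-- **Euler-product majorant.** For a weight `w ≥ 0` on the primes, a finite set `s ⊆ ℕ` and a finite
set `F` of `s`-factored numbers (all prime factors in `s`):
`Σ_{n∈F} τ₂(n)²(∏_{q∣n}w(q))/n ≤ ∏_{p∈s prime}(1 + w(p)(4/p + 180/p²))` — the sum over ALL `s`-factored
numbers equals the Euler product of the local factors (Mathlib
`EulerProduct.summable_and_hasSum_factoredNumbers_prod_filter_prime_tsum`), each at most
`1 + w(p)(4/p + 180/p²)` (`tsum_tauSqW_prime_pow_le`). [cite: Zhang2022LandauSiegel, §15 p.87] -/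
theorem sum_tauSqW_le_prod {w : ℕ → ℝ} (hw : ∀ q, 0 ≤ w q) (s : Finset ℕ) (F : Finset ℕ)
    (hF : ∀ n ∈ F, n ∈ Nat.factoredNumbers s) :
    ∑ n ∈ F, ((n.divisors.card : ℝ) ^ 2 * ∏ q ∈ n.primeFactors, w q) / (n : ℝ) ≤
      ∏ p ∈ s with p.Prime, (1 + w p * (4 / p + 180 / (p : ℝ) ^ 2)) := by
  classical
  set t : ℕ → ℝ := fun n => ((n.divisors.card : ℝ) ^ 2 * ∏ p ∈ n.primeFactors, w p) / (n : ℝ)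
    with ht
  show ∑ n ∈ F, t n ≤ _
  obtain ⟨-, hHas⟩ := EulerProduct.summable_and_hasSum_factoredNumbers_prod_filter_prime_tsum
    (f := t) (tauSqW_one w) (fun hmn => tauSqW_mul w hmn)
    (fun hp => (tsum_tauSqW_prime_pow_le hw hp).1) s
  have h1 : ∑ m ∈ F.subtype (· ∈ Nat.factoredNumbers s), t (m : ℕ) = ∑ n ∈ F, t n :=
    Finset.sum_subtype_of_mem t hF
  rw [← h1]
  refine (sum_le_hasSum _ (fun m _ => tauSqW_nonneg hw _) hHas).trans ?_
  refine Finset.prod_le_prod (fun p _ => tsum_nonneg fun a => tauSqW_nonneg hw _) fun p hp => ?_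
  exact (tsum_tauSqW_prime_pow_le hw (Finset.mem_filter.mp hp).2).2

/-- **Euler-product majorant, exponential form**: under the hypotheses of `sum_tauSqW_le_prod`,
`Σ_{n∈F} τ₂(n)²(∏_{q∣n}w(q))/n ≤ exp(Σ_{p∈s prime} w(p)(4/p + 180/p²))` (`1 + y ≤ eʸ`).
[cite: Zhang2022LandauSiegel, §15 p.87] -/
theorem sum_tauSqW_le_exp {w : ℕ → ℝ} (hw : ∀ q, 0 ≤ w q) (s : Finset ℕ) (F : Finset ℕ)
    (hF : ∀ n ∈ F, n ∈ Nat.factoredNumbers s) :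
    ∑ n ∈ F, ((n.divisors.card : ℝ) ^ 2 * ∏ q ∈ n.primeFactors, w q) / (n : ℝ) ≤
      Real.exp (∑ p ∈ s with p.Prime, w p * (4 / p + 180 / (p : ℝ) ^ 2)) := by
  refine (sum_tauSqW_le_prod hw s F hF).trans ?_
  rw [Real.exp_sum]
  refine Finset.prod_le_prod (fun p _ => ?_) fun p _ => ?_
  · have : 0 ≤ w p * (4 / p + 180 / (p : ℝ) ^ 2) := mul_nonneg (hw p) (by positivity)
    linarith
  · linarith [Real.add_one_le_exp (w p * (4 / p + 180 / (p : ℝ) ^ 2))]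

/-! ## §4. Mertens' second theorem: the plain bound and the window form -/

/-- **`Σ_{p<X} 1/p ≤ log log X + 4`** for `X ≥ 2` (primes strictly below `X`; tree
`MertensBound.sum_inv_prime_le`, Hardy–Wright Thm 427 upper half). [cite: HardyWright2008, Thm 427] -/
theorem sum_inv_primesBelow_le {X : ℕ} (hX : 2 ≤ X) :
    ∑ p ∈ Nat.primesBelow X, (1 : ℝ) / p ≤ Real.log (Real.log X) + 4 := by
  have h := Literature.NumberTheory.LFunctions.MertensBound.sum_inv_prime_le X hX
  refine le_trans ?_ h
  refine Finset.sum_le_sum_of_subset_of_nonneg (fun p hp => ?_) fun p _ _ => by positivity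
  rw [Nat.mem_primesBelow] at hp
  exact Nat.mem_primesLE.mpr ⟨hp.1.le, hp.2⟩

/-- **Mertens, window form**: for `2 ≤ A ≤ B`,
`Σ_{A<p≤B} 1/p ≤ log log B − log log A + 24` (from the two-sided bound with rate
`|Σ_{p≤x}1/p − log log x − B₁| ≤ 8/log x`, tree `Mertens.abs_primeRecipSum_sub_le`; `16/log 2 < 24`).
[cite: HardyWright2008, Thm 427] -/
theorem sum_inv_primes_Ioc_le {A B : ℕ} (hA : 2 ≤ A) (hAB : A ≤ B) :
    ∑ p ∈ (Finset.Ioc A B).filter Nat.Prime, (1 : ℝ) / p ≤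
      Real.log (Real.log B) - Real.log (Real.log A) + 24 := by
  have hA' : (2 : ℝ) ≤ A := by exact_mod_cast hA
  have hB' : (2 : ℝ) ≤ B := by exact_mod_cast hA.trans hAB
  have eA := abs_le.mp (Literature.NumberTheory.LFunctions.Mertens.abs_primeRecipSum_sub_le hA')
  have eB := abs_le.mp (Literature.NumberTheory.LFunctions.Mertens.abs_primeRecipSum_sub_le hB')
  have hPA : Literature.NumberTheory.LFunctions.Mertens.primeRecipSum (A : ℝ) =
      ∑ p ∈ Nat.primesLE A, (p : ℝ)⁻¹ := by
    rw [Literature.NumberTheory.LFunctions.Mertens.primeRecipSum, Nat.floor_natCast]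
  have hPB : Literature.NumberTheory.LFunctions.Mertens.primeRecipSum (B : ℝ) =
      ∑ p ∈ Nat.primesLE B, (p : ℝ)⁻¹ := by
    rw [Literature.NumberTheory.LFunctions.Mertens.primeRecipSum, Nat.floor_natCast]
  have hsub : Nat.primesLE A ⊆ Nat.primesLE B := fun p hp => by
    rw [Nat.mem_primesLE] at hp ⊢
    exact ⟨hp.1.trans hAB, hp.2⟩
  have hset : (Finset.Ioc A B).filter Nat.Prime = Nat.primesLE B \ Nat.primesLE A := by
    ext p
    simp only [Finset.mem_filter, Finset.mem_Ioc, Finset.mem_sdiff, Nat.mem_primesLE]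
    constructor
    · rintro ⟨⟨h1, h2⟩, hp⟩
      exact ⟨⟨h2, hp⟩, fun h => absurd h.1 (not_le.mpr h1)⟩
    · rintro ⟨⟨h2, hp⟩, h3⟩
      exact ⟨⟨not_le.mp fun h => h3 ⟨h, hp⟩, h2⟩, hp⟩
  have hdiff : ∑ p ∈ (Finset.Ioc A B).filter Nat.Prime, (1 : ℝ) / p =
      Literature.NumberTheory.LFunctions.Mertens.primeRecipSum (B : ℝ) -
        Literature.NumberTheory.LFunctions.Mertens.primeRecipSum (A : ℝ) := by
    rw [hset, hPA, hPB, ← Finset.sum_sdiff hsub]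
    simp only [one_div]
    ring
  rw [hdiff]
  have hlog2 : (0.6931471803 : ℝ) < Real.log 2 := Real.log_two_gt_d9
  have hlA : Real.log 2 ≤ Real.log A := Real.log_le_log (by norm_num) hA'
  have hlB : Real.log 2 ≤ Real.log B := Real.log_le_log (by norm_num) hB'
  have hl2 : 0 < Real.log 2 := by linarith
  have h8A : 8 / Real.log A ≤ 8 / Real.log 2 := div_le_div_of_nonneg_left (by norm_num) hl2 hlA
  have h8B : 8 / Real.log B ≤ 8 / Real.log 2 := div_le_div_of_nonneg_left (by norm_num) hl2 hlB
  have h82 : 8 / Real.log 2 ≤ 12 := by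
    rw [div_le_iff₀ hl2]; linarith
  linarith [eA.1, eB.2]

end Literature.NumberTheory.LFunctions.Zhang2022.EulerMajorant
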